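import Literature.Algebra.Homology.BilinearMapHomology

/-!
# Naturality of the descended bilinear pairing on homology

For cochain complexes of `R`-modules `C, D, E` and `C', D', E'` with bilinear cochain pairings
`φ : Cᵖ ⊗ Dᵠ ⟶ Eⁿ`, `φ' : C'ᵖ ⊗ D'ᵠ ⟶ E'ⁿ` descending to homology (`bilinearHomologyMap`, ★
`Algebra/Homology/BilinearMapHomology`), cochain maps `F : C ⟶ C'`, `G : D ⟶ D'`, `K : E ⟶ E'` which intertwine the
pairings — strictly on cochains (`bilinearHomologyMap_naturality`), or on cycles up to a boundary
(`bilinearHomologyMap_naturality_of_boundary`, the shape delivered by Čech pull-backs along non-monotone index maps) —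
are MULTIPLICATIVE ON CLASSES: `bilinearHomologyMap φ ≫ Hⁿ(K) = (Hᵖ(F) ⊗ Hᵠ(G)) ≫ bilinearHomologyMap φ'`.
[cite: CartanEilenberg1956, IV.6] [cite: Weibel1994, Thm. 3.6.3]  Pure homological algebra over Mathlib; no definition.
-/

open CategoryTheory CategoryTheory.Category CategoryTheory.Limits CategoryTheory.MonoidalCategory HomologicalComplex

universe u

namespace Literature.Algebra.Homology

variable {R : Type u} [CommRing R] (C D E : CochainComplex (ModuleCat.{u} R) ℤ)

set_option backward.isDefEq.respectTransparency false

noncomputable section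

variable {p₀ p q₀ q n₀ n : ℤ} (hp : p₀ + 1 = p) (hq : q₀ + 1 = q) (hn : n₀ + 1 = n)
  (φ : C.X p ⊗ D.X q ⟶ E.X n) (h1 : (C.iCycles p ⊗ₘ D.iCycles q) ≫ φ ≫ E.d n (n + 1) = 0)
  (ψ₁ : C.X p₀ ⊗ D.cycles q ⟶ E.X n₀) (h2 : (C.d p₀ p ▷ D.cycles q) ≫ (C.X p ◁ D.iCycles q) ≫ φ = ψ₁ ≫ E.d n₀ n)
  (ψ₂ : C.cycles p ⊗ D.X q₀ ⟶ E.X n₀) (h3 : (C.cycles p ◁ D.d q₀ q) ≫ (C.iCycles p ▷ D.X q) ≫ φ = ψ₂ ≫ E.d n₀ n)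

/-- **Naturality of the descended pairing** («a cochain map compatible with the pairings is multiplicative on
classes»): for cochain maps `F : C ⟶ C'`, `G : D ⟶ D'`, `K : E ⟶ E'` intertwining `φ` and `φ'` on cochains,
`φ ≫ Kⁿ = (Fᵖ ⊗ Gᵠ) ≫ φ'`, the descended pairings satisfy
`bilinearHomologyMap φ ≫ Hⁿ(K) = (Hᵖ(F) ⊗ Hᵠ(G)) ≫ bilinearHomologyMap φ'`.  (Both sides agree after the epimorphism
`π ⊗ π`, where they are `z ⊗ w ↦ [K φ(z ⊗ w)] = [φ'(Fz ⊗ Gw)]`.) [cite: CartanEilenberg1956, IV.6]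
[cite: Weibel1994, Thm. 3.6.3] -/
theorem bilinearHomologyMap_naturality {C' D' E' : CochainComplex (ModuleCat.{u} R) ℤ} (F : C ⟶ C') (G : D ⟶ D')
    (K : E ⟶ E') (φ' : C'.X p ⊗ D'.X q ⟶ E'.X n)
    (h1' : (C'.iCycles p ⊗ₘ D'.iCycles q) ≫ φ' ≫ E'.d n (n + 1) = 0) (ψ₁' : C'.X p₀ ⊗ D'.cycles q ⟶ E'.X n₀)
    (h2' : (C'.d p₀ p ▷ D'.cycles q) ≫ (C'.X p ◁ D'.iCycles q) ≫ φ' = ψ₁' ≫ E'.d n₀ n)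
    (ψ₂' : C'.cycles p ⊗ D'.X q₀ ⟶ E'.X n₀)
    (h3' : (C'.cycles p ◁ D'.d q₀ q) ≫ (C'.iCycles p ▷ D'.X q) ≫ φ' = ψ₂' ≫ E'.d n₀ n)
    (hcomm : φ ≫ K.f n = (F.f p ⊗ₘ G.f q) ≫ φ') :
    bilinearHomologyMap C D E hp hq hn φ h1 ψ₁ h2 ψ₂ h3 ≫ HomologicalComplex.homologyMap K n =
      (HomologicalComplex.homologyMap F p ⊗ₘ HomologicalComplex.homologyMap G q) ≫
        bilinearHomologyMap C' D' E' hp hq hn φ' h1' ψ₁' h2' ψ₂' h3' := by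
  apply hom_ext_homologyπ_tensor' C D hp hq
  -- on cycles: `cpc(φ) ≫ Zⁿ(K) = (Zᵖ(F) ⊗ Zᵠ(G)) ≫ cpc(φ')`
  have hcyc : cyclesPairingToCycles C D E φ h1 ≫ HomologicalComplex.cyclesMap K n =
      (HomologicalComplex.cyclesMap F p ⊗ₘ HomologicalComplex.cyclesMap G q) ≫ cyclesPairingToCycles C' D' E' φ' h1' := by
    rw [← cancel_mono (E'.iCycles n), assoc, HomologicalComplex.cyclesMap_i, cyclesPairingToCycles_i_assoc, assoc,
      cyclesPairingToCycles_i, cyclesPairingι, cyclesPairingι, assoc, hcomm, tensorHom_comp_tensorHom_assoc,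
      ← HomologicalComplex.cyclesMap_i F p, ← HomologicalComplex.cyclesMap_i G q, tensorHom_comp_tensorHom_assoc]
  rw [homologyπ_tensor_bilinearHomologyMap_assoc, cyclesPairingToHomology, assoc, HomologicalComplex.homologyπ_naturality,
    reassoc_of% hcyc, tensorHom_comp_tensorHom_assoc, HomologicalComplex.homologyπ_naturality F p,
    HomologicalComplex.homologyπ_naturality G q, ← tensorHom_comp_tensorHom, assoc,
    homologyπ_tensor_bilinearHomologyMap, cyclesPairingToHomology]

/-- **Naturality up to a coboundary**: the same conclusion when the cochain maps intertwine the pairings on CYCLES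
only UP TO A BOUNDARY, `(ι ⊗ ι) ≫ φ ≫ Kⁿ = (ι ⊗ ι) ≫ (Fᵖ ⊗ Gᵠ) ≫ φ' + η ≫ d` (the shape delivered by pull-backs along
non-monotone index maps, which are multiplicative on ordered cochains only modulo coboundaries).
[cite: CartanEilenberg1956, IV.6] [cite: Weibel1994, Thm. 3.6.3] -/
theorem bilinearHomologyMap_naturality_of_boundary {C' D' E' : CochainComplex (ModuleCat.{u} R) ℤ} (F : C ⟶ C')
    (G : D ⟶ D') (K : E ⟶ E') (φ' : C'.X p ⊗ D'.X q ⟶ E'.X n)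
    (h1' : (C'.iCycles p ⊗ₘ D'.iCycles q) ≫ φ' ≫ E'.d n (n + 1) = 0) (ψ₁' : C'.X p₀ ⊗ D'.cycles q ⟶ E'.X n₀)
    (h2' : (C'.d p₀ p ▷ D'.cycles q) ≫ (C'.X p ◁ D'.iCycles q) ≫ φ' = ψ₁' ≫ E'.d n₀ n)
    (ψ₂' : C'.cycles p ⊗ D'.X q₀ ⟶ E'.X n₀)
    (h3' : (C'.cycles p ◁ D'.d q₀ q) ≫ (C'.iCycles p ▷ D'.X q) ≫ φ' = ψ₂' ≫ E'.d n₀ n)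
    (η : C.cycles p ⊗ D.cycles q ⟶ E'.X n₀)
    (hcomm : (C.iCycles p ⊗ₘ D.iCycles q) ≫ φ ≫ K.f n =
      (C.iCycles p ⊗ₘ D.iCycles q) ≫ (F.f p ⊗ₘ G.f q) ≫ φ' + η ≫ E'.d n₀ n) :
    bilinearHomologyMap C D E hp hq hn φ h1 ψ₁ h2 ψ₂ h3 ≫ HomologicalComplex.homologyMap K n =
      (HomologicalComplex.homologyMap F p ⊗ₘ HomologicalComplex.homologyMap G q) ≫
        bilinearHomologyMap C' D' E' hp hq hn φ' h1' ψ₁' h2' ψ₂' h3' := by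
  apply hom_ext_homologyπ_tensor' C D hp hq
  -- the boundary correction, as a map to cycles
  have hηd : (η ≫ E'.d n₀ n) ≫ E'.d n (n + 1) = 0 := by simp
  have hcyc : cyclesPairingToCycles C D E φ h1 ≫ HomologicalComplex.cyclesMap K n =
      (HomologicalComplex.cyclesMap F p ⊗ₘ HomologicalComplex.cyclesMap G q) ≫ cyclesPairingToCycles C' D' E' φ' h1' +
        E'.liftCycles (η ≫ E'.d n₀ n) (n + 1) (by simp) hηd := by
    rw [← cancel_mono (E'.iCycles n), assoc, HomologicalComplex.cyclesMap_i, cyclesPairingToCycles_i_assoc,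
      cyclesPairingι, assoc, hcomm, Preadditive.add_comp, assoc, cyclesPairingToCycles_i, cyclesPairingι,
      liftCycles_i, tensorHom_comp_tensorHom_assoc, ← HomologicalComplex.cyclesMap_i F p,
      ← HomologicalComplex.cyclesMap_i G q, tensorHom_comp_tensorHom_assoc]
  have hzero : E'.liftCycles (η ≫ E'.d n₀ n) (n + 1) (by simp) hηd ≫ E'.homologyπ n = 0 := by
    subst hn
    exact E'.liftCycles_homologyπ_eq_zero_of_boundary _ (n₀ + 1 + 1) (by simp) η rfl
  rw [homologyπ_tensor_bilinearHomologyMap_assoc, cyclesPairingToHomology, assoc, HomologicalComplex.homologyπ_naturality,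
    reassoc_of% hcyc, Preadditive.add_comp, assoc, hzero, add_zero, tensorHom_comp_tensorHom_assoc,
    HomologicalComplex.homologyπ_naturality F p, HomologicalComplex.homologyπ_naturality G q, ← tensorHom_comp_tensorHom,
    assoc, homologyπ_tensor_bilinearHomologyMap, cyclesPairingToHomology]

end

end Literature.Algebra.Homology
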